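import Literature.NumberTheory.LocalFields.RamifiedQuadraticOrderUnitIndex      -- ★ (F3b) B-p04: `S = S^σ ⊕ S^σ ϖ`, parity of `σ x − x`
import HarnessLib

/-!
# Mars' lattice lemma for ANY involution (in particular the RAMIFIED one): a lattice `Λ ∋ 1` stable under the fixed ring is `{x : σ x − x ∈ 𝔪^j}`; general position
# `Λ = z · {…}`; in the ramified case the exponent is odd and `{σ x − x ∈ 𝔪^{2i+1}} = S^σ + ϖ^{2i}·S`
(Flicker, *Elementary proof of the fundamental lemma for a unitary group* (1998), REMARK p. 84, Prop. 6 (second half) p. 83; Serre, *Local Fields*, Ch. IV §1)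

Topic `NumberTheory/LocalFields`; namespace `Literature.NumberTheory.LocalFields.RamifiedQuadraticOrder` (= ★ (F3b) `RamifiedQuadraticOrderUnitIndex`).  THEOREMS
ONLY (no `def`, no instance, no notation, no named fact, no `sorry`).  Cell `pub/hodgecm-mathlib`, F0∕P3a road «N7-ns COUNT FROM FLICKER» (MAP v3, architect A-p06
(g26)), brick **(F3c-i′)** (B-p04 (g33), self-dealt 05:37Z with LEAD∕architect silent-«=»): the lattice classification behind the TYPE-(2) Prop. 6 (B-p14 (g30)'s
census 8d487f29 §3: `stub_irredGValuePos` needs `H = ⊔_j T_H r_j K_H` for the type-(2) torus, weight `q^j` = ★ (F3b) `index_comap_eqLocus_odd_eq_pow`).  TWIN of ★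
(F3c-i) `UnramifiedQuadraticOrderLattices` (p840815 ∕ p840883) — and in fact §1 here needs NO (un)ramifiedness: the anti-fixed parts `σ x − x` replace the
`v`-coordinate, their RATIOS are fixed.  HC_CM is proved only modulo the printed citations until rung 0 closes; pays nothing by itself.

FRAME: `S` a DVR (`[IsDomain S] [IsDiscreteValuationRing S]`), `σ : S →+* S` with `hσ : σσ = id`, `h2 : IsUnit 2`; §2 adds the ramified tokens of ★ (F3b):
`hres : ∀ x, σ x − x ∈ 𝔪`, `hϖ : Irreducible ϖ`, `hσϖ : σ ϖ = −ϖ`.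
* §1 **`exists_forall_mem_iff_map_sub_self_mem_pow (Λ : AddSubgroup S) (hmul : ∀ r x, σ r = r → x ∈ Λ → r x ∈ Λ) (h1 : 1 ∈ Λ) (hnf : ∃ x ∈ Λ, σ x ≠ x) :
  ∃ j, ∀ x, x ∈ Λ ↔ σ x − x ∈ 𝔪^j`**; **`exists_forall_mem_iff_exists_map_sub_self_mem_pow_and_eq_mul`** (general position `Λ = z·{y : σ y − y ∈ 𝔪^j}`, `z ∈ Λ` of least
  valuation, for `Λ ≠ 0` not inside a line `z·S^σ`).
* §2 (ramified) **`map_sub_self_mem_pow_odd_iff : σ x − x ∈ 𝔪^{2i+1} ↔ ∃ a b, σa = a ∧ σb = b ∧ ϖ^{2i} ∣ b ∧ x = a + bϖ`** (= the order `S^σ + ϖ^{2i} S`),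
  `exists_forall_mem_pow_iff_mem_pow_odd` (every exponent is equivalent to an odd one), **`exists_forall_mem_iff_map_sub_self_mem_pow_odd`** (Mars, ramified,
  normalised: `Λ = S^σ + ϖ^{2i}S`), **`eq_of_forall_map_sub_self_mem_pow_odd_iff`** (the odd exponent is unique).

## References
* [Flicker1998UnitaryFL] Y. Z. Flicker, *Elementary proof of the fundamental lemma for a unitary group*, Canad. J. Math. 50 (1998), p. 84 REMARK; Prop. 6 p. 83.
* [Serre1979] J.-P. Serre, *Local Fields*, GTM 67 (1979), Ch. IV §1 Prop. 3.
-/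

namespace Literature.NumberTheory.LocalFields.RamifiedQuadraticOrder

open IsLocalRing Literature.NumberTheory.LocalFields.UnramifiedQuadraticNorm

universe u

variable {S : Type u} [CommRing S] (σ : S →+* S)

/-! ## §1 The lattice lemma with a general involution (no ramification hypothesis needed) -/

section Lattice

variable [IsDomain S] [IsDiscreteValuationRing S] (hσ : ∀ x, σ (σ x) = x) (h2 : IsUnit (2 : S))

include hσ h2 in
/-- **MARS' LATTICE LEMMA (any involution `σ` of a DVR with `2` a unit), normalised at `1 ∈ Λ`**: an additive subgroup `Λ ≤ S` containing `1`, stable under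
multiplication by `σ`-fixed elements and not pointwise fixed is `{x : σ x − x ∈ 𝔪^j}` for some `j` (= the order `S^σ + 𝔪^j`-part: `x = (x+σx)∕2 + (x−σx)∕2`, the
first summand fixed hence in `Λ`; the anti-fixed parts of `Λ` are the multiples — by FIXED ratios — of one of least valuation).  Unramified twin: ★
`UnramifiedQuadraticNorm.exists_forall_mem_iff_map_sub_self_mem_pow`. [cite: Flicker1998UnitaryFL, p. 84 REMARK, Prop. 6 p. 83] [cite: Serre1979, Ch. IV §1 Prop. 3] -/
theorem exists_forall_mem_iff_map_sub_self_mem_pow (Λ : AddSubgroup S) (hmul : ∀ r x, σ r = r → x ∈ Λ → r * x ∈ Λ) (h1 : (1 : S) ∈ Λ)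
    (hnf : ∃ x ∈ Λ, σ x ≠ x) : ∃ j : ℕ, ∀ x, x ∈ Λ ↔ σ x - x ∈ maximalIdeal S ^ j := by
  classical
  obtain ⟨ϖ, hϖ⟩ := IsDiscreteValuationRing.exists_irreducible S
  have hm : maximalIdeal S = Ideal.span {ϖ} := (IsDiscreteValuationRing.irreducible_iff_uniformizer ϖ).1 hϖ
  obtain ⟨t, ht⟩ := h2.exists_left_inv   -- `t * 2 = 1`
  have hσt : σ t = t := by
    have h1' : σ t * 2 = 1 := by have := congrArg σ ht; rwa [map_mul, map_ofNat, map_one] at this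
    exact mul_right_cancel₀ h2.ne_zero (by rw [h1', ht])
  -- fixed elements lie in `Λ`; the fixed part `(x + σx) t` of any `x`
  have hfix : ∀ r, σ r = r → r ∈ Λ := fun r hr => by simpa using hmul r 1 hr h1
  have hufix : ∀ x, σ ((x + σ x) * t) = (x + σ x) * t := fun x => by rw [map_mul, map_add, hσ, hσt, add_comm]
  have hdec : ∀ x, x = (x + σ x) * t + -((σ x - x) * t) := fun x => by linear_combination -(x * ht)
  -- the exponents of the anti-fixed parts `σ x − x` on `Λ`
  have hP : ∃ n, ∃ x ∈ Λ, ∃ ε : Sˣ, σ x - x = ↑ε * ϖ ^ n := by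
    obtain ⟨x, hx, hne⟩ := hnf
    obtain ⟨n, ε, h⟩ := IsDiscreteValuationRing.eq_unit_mul_pow_irreducible (sub_ne_zero.2 hne) hϖ
    exact ⟨n, x, hx, ε, h⟩
  obtain ⟨x₀, hx₀, ε₀, hv₀⟩ := Nat.find_spec hP
  set j := Nat.find hP with hj
  have hv₀0 : σ x₀ - x₀ ≠ 0 := by rw [hv₀]; exact mul_ne_zero (Units.ne_zero _) (pow_ne_zero _ hϖ.ne_zero)
  -- the anti-fixed part of `x₀` (times `t`) lies in `Λ`
  have hw₀ : -((σ x₀ - x₀) * t) ∈ Λ := by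
    have h := Λ.sub_mem hx₀ (hfix _ (hufix x₀))
    rwa [show x₀ - (x₀ + σ x₀) * t = -((σ x₀ - x₀) * t) by linear_combination (-x₀) * ht] at h
  refine ⟨j, fun x => ⟨fun hx => ?_, fun hx => ?_⟩⟩
  · -- `x ∈ Λ ⇒ ϖ^j ∣ σ x − x`
    rw [hm, Ideal.span_singleton_pow, Ideal.mem_span_singleton]
    by_cases hvx : σ x - x = 0
    · rw [hvx]; exact dvd_zero _
    · obtain ⟨n, ε, hn⟩ := IsDiscreteValuationRing.eq_unit_mul_pow_irreducible hvx hϖ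
      have hjn : j ≤ n := Nat.find_min' hP ⟨x, hx, ε, hn⟩
      rw [hn]
      exact Dvd.dvd.mul_left (pow_dvd_pow ϖ hjn) _
  · -- `ϖ^j ∣ σ x − x ⇒ σ x − x = q (σ x₀ − x₀)` with `q` FIXED `⇒ x = u(x) + q · w₀ ∈ Λ`
    rw [hm, Ideal.span_singleton_pow, Ideal.mem_span_singleton] at hx
    obtain ⟨s, hs⟩ := hx
    set q : S := ((ε₀⁻¹ : Sˣ) : S) * s with hq
    have hε : ((ε₀⁻¹ : Sˣ) : S) * (ε₀ : S) = 1 := Units.inv_mul ε₀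
    have hvq : σ x - x = q * (σ x₀ - x₀) := by
      rw [hs, hv₀, hq]; linear_combination -(s * ϖ ^ j) * hε
    have hqfix : σ q = q := by
      -- the ratio of two anti-fixed elements is fixed
      have h := congrArg σ hvq
      rw [map_sub, hσ, map_mul, map_sub, hσ, show x - σ x = -(σ x - x) by ring, hvq, show x₀ - σ x₀ = -(σ x₀ - x₀) by ring,
        mul_neg, neg_inj] at h
      exact (mul_right_cancel₀ hv₀0 h).symm
    rw [hdec x, show -((σ x - x) * t) = q * -((σ x₀ - x₀) * t) by rw [hvq]; ring]
    exact Λ.add_mem (hfix _ (hufix x)) (hmul q _ hqfix hw₀)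

include hσ h2 in
/-- **MARS' LATTICE LEMMA, GENERAL FORM `Λ = z · {y : σ y − y ∈ 𝔪^j}`** (any involution, `2` a unit): a nonzero additive subgroup `Λ ≤ S` stable under the fixed
ring and not contained in a line `z · S^σ` is `z · Λ″` with `z ∈ Λ` of least valuation and `Λ″ = {y : σ y − y ∈ 𝔪^j}`.  Unramified twin: ★
`exists_forall_mem_iff_exists_map_sub_self_mem_pow_and_eq_mul`. [cite: Flicker1998UnitaryFL, p. 84 REMARK, Prop. 6 p. 83] -/
theorem exists_forall_mem_iff_exists_map_sub_self_mem_pow_and_eq_mul (Λ : AddSubgroup S) (hmul : ∀ r x, σ r = r → x ∈ Λ → r * x ∈ Λ)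
    (hne : ∃ x ∈ Λ, x ≠ 0) (hrk : ¬ ∃ z : S, ∀ x ∈ Λ, ∃ r, σ r = r ∧ x = z * r) :
    ∃ (z : S) (j : ℕ), z ∈ Λ ∧ z ≠ 0 ∧ ∀ x, x ∈ Λ ↔ ∃ y, σ y - y ∈ maximalIdeal S ^ j ∧ x = z * y := by
  classical
  obtain ⟨ϖ, hϖ⟩ := IsDiscreteValuationRing.exists_irreducible S
  have hP : ∃ n, ∃ x ∈ Λ, ∃ ε : Sˣ, x = ↑ε * ϖ ^ n := by
    obtain ⟨x, hx, hx0⟩ := hne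
    obtain ⟨n, ε, h⟩ := IsDiscreteValuationRing.eq_unit_mul_pow_irreducible hx0 hϖ
    exact ⟨n, x, hx, ε, h⟩
  obtain ⟨z, hz, ε₀, hzε⟩ := Nat.find_spec hP
  have hz0 : z ≠ 0 := by rw [hzε]; exact mul_ne_zero (Units.ne_zero _) (pow_ne_zero _ hϖ.ne_zero)
  have hdiv : ∀ x ∈ Λ, ∃ y, x = z * y := by
    intro x hx
    by_cases hx0 : x = 0
    · exact ⟨0, by rw [hx0, mul_zero]⟩
    obtain ⟨m, ε, hxε⟩ := IsDiscreteValuationRing.eq_unit_mul_pow_irreducible hx0 hϖ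
    have hnm : Nat.find hP ≤ m := Nat.find_min' hP ⟨x, hx, ε, hxε⟩
    refine ⟨↑ε₀⁻¹ * ↑ε * ϖ ^ (m - Nat.find hP), ?_⟩
    have hpow : ϖ ^ m = ϖ ^ Nat.find hP * ϖ ^ (m - Nat.find hP) := by rw [← pow_add, Nat.add_sub_cancel' hnm]
    have hε : (ε₀ : S) * ↑ε₀⁻¹ = 1 := Units.mul_inv ε₀
    rw [hxε, hzε, hpow]
    linear_combination -((ε : S) * ϖ ^ Nat.find hP * ϖ ^ (m - Nat.find hP)) * hε
  set Λ'' : AddSubgroup S := Λ.comap (AddMonoidHom.mulLeft z) with hΛ''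
  have hmem'' : ∀ y, y ∈ Λ'' ↔ z * y ∈ Λ := fun y => Iff.rfl
  have hmul'' : ∀ r y, σ r = r → y ∈ Λ'' → r * y ∈ Λ'' := by
    intro r y hr hy
    rw [hmem''] at hy ⊢
    rw [mul_left_comm]
    exact hmul r _ hr hy
  have h1'' : (1 : S) ∈ Λ'' := by rw [hmem'', mul_one]; exact hz
  have hnf'' : ∃ y ∈ Λ'', σ y ≠ y := by
    by_contra hall
    apply hrk
    refine ⟨z, fun x hx => ?_⟩
    obtain ⟨y, rfl⟩ := hdiv x hx
    refine ⟨y, ?_, rfl⟩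
    by_contra hy
    exact hall ⟨y, (hmem'' y).2 hx, hy⟩
  obtain ⟨j, hj⟩ := exists_forall_mem_iff_map_sub_self_mem_pow σ hσ h2 Λ'' hmul'' h1'' hnf''
  refine ⟨z, j, hz, hz0, fun x => ⟨fun hx => ?_, ?_⟩⟩
  · obtain ⟨y, rfl⟩ := hdiv x hx
    exact ⟨y, (hj y).1 ((hmem'' y).2 hx), rfl⟩
  · rintro ⟨y, hy, rfl⟩
    exact (hmem'' y).1 ((hj y).2 hy)

end Lattice

/-! ## §2 The ramified case: odd exponents, and the orders `S^σ + ϖ^{2i} S = {x : σ x − x ∈ 𝔪^{2i+1}}` -/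

section Ramified

variable [IsDomain S] [IsDiscreteValuationRing S] (hσ : ∀ x, σ (σ x) = x) (hres : ∀ x, σ x - x ∈ maximalIdeal S)
  {ϖ : S} (hϖ : Irreducible ϖ) (hσϖ : σ ϖ = -ϖ) (h2 : IsUnit (2 : S))

include hσ hres hϖ hσϖ h2 in
/-- **THE ORDERS OF A RAMIFIED QUADRATIC EXTENSION**: `σ x − x ∈ 𝔪^{2i+1} ⟺ x = a + b ϖ` with `a, b` `σ`-fixed and `ϖ^{2i} ∣ b` — i.e. `x ∈ S^σ + π^i·S`
(`π = ϖ²` up to a unit), Flicker's `R_E(j)`-analogue for the ramified torus. [cite: Serre1979, Ch. IV §1 Prop. 3] [cite: Flicker1998UnitaryFL, Prop. 6 p. 83] -/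
theorem map_sub_self_mem_pow_odd_iff (i : ℕ) (x : S) :
    σ x - x ∈ maximalIdeal S ^ (2 * i + 1) ↔ ∃ a b : S, σ a = a ∧ σ b = b ∧ ϖ ^ (2 * i) ∣ b ∧ x = a + b * ϖ := by
  have hm : maximalIdeal S = Ideal.span {ϖ} := (IsDiscreteValuationRing.irreducible_iff_uniformizer ϖ).1 hϖ
  rw [hm, Ideal.span_singleton_pow, Ideal.mem_span_singleton]
  constructor
  · intro h
    obtain ⟨a, b, ha, hb, hx⟩ := exists_fixed_add_fixed_mul σ hσ hres hϖ hσϖ h2 x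
    refine ⟨a, b, ha, hb, ?_, hx⟩
    have e : σ x - x = -(2 * b) * ϖ := by rw [hx, map_add, map_mul, ha, hb, hσϖ]; ring
    rw [e, pow_succ] at h
    have h' : ϖ ^ (2 * i) ∣ -(2 * b) := (mul_dvd_mul_iff_right hϖ.ne_zero).1 h
    rw [dvd_neg] at h'
    exact (h2.dvd_mul_left).1 h'
  · rintro ⟨a, b, ha, hb, ⟨c, rfl⟩, rfl⟩
    refine ⟨-(2 * c), ?_⟩
    have h1 : σ (ϖ ^ (2 * i)) = ϖ ^ (2 * i) := by rw [map_pow, hσϖ, neg_pow, pow_mul, neg_one_sq, one_pow, one_mul]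
    have hc : σ c = c := by
      have h3 : ϖ ^ (2 * i) * σ c = ϖ ^ (2 * i) * c := by
        have := hb; rwa [map_mul, h1] at this
      exact mul_left_cancel₀ (pow_ne_zero _ hϖ.ne_zero) h3
    rw [map_add, map_mul, map_mul, h1, ha, hσϖ, hc]
    ring

include hσ hres hϖ hσϖ h2 in
/-- In the ramified case the exponent may be taken ODD: `{x : σ x − x ∈ 𝔪^j} = {x : σ x − x ∈ 𝔪^{2i+1}}` for a suitable `i` (`σ x − x ∈ 𝔪` always, and
`σ x − x ∈ 𝔪^{2i+2} ⇒ ∈ 𝔪^{2i+3}` — ★ `map_sub_self_mem_pow_succ_of_even`). [cite: Serre1979, Ch. IV §1 Prop. 3] -/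
theorem exists_forall_mem_pow_iff_mem_pow_odd (j : ℕ) : ∃ i : ℕ, ∀ x : S, σ x - x ∈ maximalIdeal S ^ j ↔ σ x - x ∈ maximalIdeal S ^ (2 * i + 1) := by
  rcases Nat.even_or_odd j with ⟨k, rfl⟩ | ⟨k, rfl⟩
  · rcases Nat.eq_zero_or_pos k with rfl | hk
    · refine ⟨0, fun x => ⟨fun _ => by rw [mul_zero, zero_add, pow_one]; exact hres x, fun _ => by rw [add_zero, pow_zero, Ideal.one_eq_top]; trivial⟩⟩
    · obtain ⟨i, rfl⟩ := Nat.exists_eq_add_of_le' hk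
      refine ⟨i + 1, fun x => ⟨fun h => ?_, fun h => Ideal.pow_le_pow_right (by omega) h⟩⟩
      have h' : σ x - x ∈ maximalIdeal S ^ (2 * i + 2) := by rw [show 2 * i + 2 = i + 1 + (i + 1) by ring]; exact h
      have := map_sub_self_mem_pow_succ_of_even σ hσ hres hϖ hσϖ h2 x i h'
      rw [show 2 * (i + 1) + 1 = 2 * i + 3 by ring]; exact this
  · exact ⟨k, fun _ => Iff.rfl⟩

include hσ hres hϖ hσϖ h2 in
/-- **MARS' LEMMA, RAMIFIED, NORMALISED**: `Λ ∋ 1` stable under `S^σ`, not pointwise fixed ⇒ `Λ = S^σ + ϖ^{2i}·S = {x : σ x − x ∈ 𝔪^{2i+1}}` for some `i`.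
[cite: Flicker1998UnitaryFL, p. 84 REMARK, Prop. 6 p. 83] [cite: Serre1979, Ch. IV §1 Prop. 3] -/
theorem exists_forall_mem_iff_map_sub_self_mem_pow_odd (Λ : AddSubgroup S) (hmul : ∀ r x, σ r = r → x ∈ Λ → r * x ∈ Λ) (h1 : (1 : S) ∈ Λ)
    (hnf : ∃ x ∈ Λ, σ x ≠ x) : ∃ i : ℕ, ∀ x, x ∈ Λ ↔ σ x - x ∈ maximalIdeal S ^ (2 * i + 1) := by
  obtain ⟨j, hj⟩ := exists_forall_mem_iff_map_sub_self_mem_pow σ hσ h2 Λ hmul h1 hnf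
  obtain ⟨i, hi⟩ := exists_forall_mem_pow_iff_mem_pow_odd σ hσ hres hϖ hσϖ h2 j
  exact ⟨i, fun x => (hj x).trans (hi x)⟩

include hϖ hσϖ h2 in
/-- **The odd exponent is unique**: `{σ x − x ∈ 𝔪^{2i+1}} = {σ x − x ∈ 𝔪^{2i′+1}} ⇒ i = i′` (test `x = ϖ^{2i+1}`: `σ x − x = −2ϖ^{2i+1}`).
[cite: Flicker1998UnitaryFL, p. 84 REMARK] -/
theorem eq_of_forall_map_sub_self_mem_pow_odd_iff {i i' : ℕ}
    (h : ∀ x : S, σ x - x ∈ maximalIdeal S ^ (2 * i + 1) ↔ σ x - x ∈ maximalIdeal S ^ (2 * i' + 1)) : i = i' := by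
  have hm : maximalIdeal S = Ideal.span {ϖ} := (IsDiscreteValuationRing.irreducible_iff_uniformizer ϖ).1 hϖ
  have key : ∀ n k : ℕ, σ (ϖ ^ (2 * n + 1)) - ϖ ^ (2 * n + 1) ∈ maximalIdeal S ^ k ↔ k ≤ 2 * n + 1 := by
    intro n k
    have e : σ (ϖ ^ (2 * n + 1)) - ϖ ^ (2 * n + 1) = -2 * ϖ ^ (2 * n + 1) := by
      rw [map_pow, hσϖ, neg_pow, pow_succ (-1 : S), pow_mul, neg_one_sq, one_pow, one_mul]; ring
    rw [e, hm, Ideal.span_singleton_pow, Ideal.mem_span_singleton, neg_mul, dvd_neg, h2.dvd_mul_left,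
      pow_dvd_pow_iff hϖ.ne_zero hϖ.not_isUnit]
  have h1 := (key i (2 * i' + 1)).1 ((h _).1 ((key i (2 * i + 1)).2 le_rfl))
  have h2' := (key i' (2 * i + 1)).1 ((h _).2 ((key i' (2 * i' + 1)).2 le_rfl))
  omega

end Ramified

end Literature.NumberTheory.LocalFields.RamifiedQuadraticOrder
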